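import Summits.ResolutionOfSingularities.ResolutionOfSingularities.Theorems.WeightedInvariantContactCylinderGenericSuccessor
import Summits.ResolutionOfSingularities.ResolutionOfSingularities.Theorems.WeightedInvariantHypersurfaceLocalGameEFT4SDimLE
import HarnessLib

/-!
# (P3a-drop), TYPE (a) — CONSUMER FORM: straight from the canonical game clause at the localised position
# (door `HypersurfaceCentreConstruction`, stmt-ResolutionOfSingularities-19897; rung P3, regime CURVE°; res-type-005, ORDER (o36a) of
# res-L1-w43-plan-1, sequel of `…ContactCylinderGenericSuccessor`)

Topic: `Summits/ResolutionOfSingularities/ResolutionOfSingularities/Theorems`. Helper for the door item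
`HypersurfaceCentreConstruction` (stmt-ResolutionOfSingularities-19897, route `WeightedInvariant`), def-free.  The assembler of the
CURVE° (drop) theorem (res-type-092, ORDER (o36)) holds, at a curve-centre position `(S, f)` with centre `P`, the canonical game
clause of a LOWER rung at the localised position `(S_P, f/1)` (e.g. `CanonicalGameClauseLE 2 p ι J₂` of the P2 rung of record) and
the cylinder presentation `(u, w)` of `…ContactCylinderPresentationLocal` with its value `(𝒥ₘ(u,w))·S_P = J₂ (S_P) (f/1) m`.
`iota_successor_lt_of_over_generic_point_of_clause` turns exactly these into the TYPE (a) half of the (drop) conjunct: the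
clause's own presentation `(u₂, w₂)` at `S_P` has the same filtration, hence the same cobordant algebra, and its centre
`P₂ ≤ 𝔪_{S_P} = P·S_P`, so its (drop) block is the hypothesis `hdrop` of `iota_successor_lt_of_over_generic_point` (p532378).
[OURS · L1 W4.3 · (o36a)]  Replaces the role of NO printed item; NOT a statement of the manuscript
[claim: Hironaka2017, status: under-review]. AI work, weaker than expert review.

## References

* J. Włodarczyk, Functorial resolution by torus actions, arXiv:2203.03090, Def. 2.3.5, App. Def. 5.1.1. [Wlodarczyk2022]
* res-L1-w43-plan-1, IOTA3-DESIGN v1.3 §8.4 (CURVE°); res-type-061 `…LocalGameEFT4SDimLE` (`CanonicalGameClauseLE`) (OURS).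
-/

noncomputable section

open IsLocalRing Literature.AlgebraicGeometry.Resolution
open Summit.ResolutionOfSingularities.ResolutionOfSingularities.Cruxes.HypersurfaceCentreConstruction.LocalEngine

set_option linter.dupNamespace false -- mandated namespace of this single-conjunct summit

namespace Summit.ResolutionOfSingularities.ResolutionOfSingularities.Theorems

namespace ContactCylinder

/-! ## Consumer form: TYPE (a) straight from the canonical game clause at the localised position -/

section Clause

/-- **(o36a), CONSUMER FORM.**  If the canonical game clause `CanonicalGameClauseLE d p ι J₂` holds (e.g. the P≤2 rung of
record at `d = 2`), then at a position `(S, f)` over a perfect field of characteristic `p` with a prime `P` such that `S_P`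
has Krull dimension `≤ d`, `0 ≠ f/1 ∈ 𝔪_{S_P}²`, `f` on the top `ι`-stratum through `P`, and a family `(u, w)` on `S` whose
weighted pieces are contracted from `S_P` and extend to `J₂ (S_P) (f/1)` (the cylinder presentation of
`…ContactCylinderPresentationLocal` with the value of `…ContactCylinderValue`): every TYPE (a) successor of the move `(u, w)`
drops — `ι (B_𝔫) (g/1) < ι S f`.  (The clause's own centre `P₂ ≤ 𝔪_{S_P} = P·S_P`, so its (drop) block applies to every
successor prime over `P·S_P`.) [OURS · L1 W4.3 · (o36a)] -/
theorem iota_successor_lt_of_over_generic_point_of_clause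
    {ι : (R : Type) → [CommRing R] → R → Ordinal.{0}} (hι : IotaIsoInvariant ι)
    {J₂ : (R : Type) → [CommRing R] → R → ℕ → Ideal R} {d p : ℕ} (hclause : CanonicalGameClauseLE d p ι J₂)
    (k₀ : Type) [Field k₀] [CharP k₀ p] [PerfectField k₀]
    (S : Type) [CommRing S] [IsRegularLocalRing S] [Algebra k₀ S] [Algebra.EssFiniteType k₀ S]
    (P : Ideal S) [P.IsPrime] (hdim : ringKrullDim (Localization.AtPrime P) ≤ d)
    (f : S) (hf0 : algebraMap S (Localization.AtPrime P) f ≠ 0)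
    (hf2 : algebraMap S (Localization.AtPrime P) f ∈ maximalIdeal (Localization.AtPrime P) ^ 2)
    (hιP : ι (Localization.AtPrime P) (algebraMap S (Localization.AtPrime P) f) = ι S f)
    {n : ℕ} (u : Fin n → S) (w : Fin n → ℕ)
    (hcontr : ∀ m, ((weightedMonomialIdeal u w m).map (algebraMap S (Localization.AtPrime P))).comap
      (algebraMap S (Localization.AtPrime P)) = weightedMonomialIdeal u w m)
    (hval : ∀ m, (weightedMonomialIdeal u w m).map (algebraMap S (Localization.AtPrime P)) =
      J₂ (Localization.AtPrime P) (algebraMap S (Localization.AtPrime P) f) m)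
    (𝔫 : Ideal (cobordantAlgebra' u w)) [𝔫.IsPrime] (hT : cobordantT' u w ∈ 𝔫)
    (hP𝔫 : P.map (algebraMap S (cobordantAlgebra' u w)) ≤ 𝔫)
    (hV : ¬ extReesAlgebra.vertexIdeal (weightedMonomialIdeal u w) ≤ 𝔫)
    (hgen : 𝔫.comap (algebraMap S (cobordantAlgebra' u w)) ≤ P)
    (a : ℕ) (g : cobordantAlgebra' u w) (hfg : algebraMap S (cobordantAlgebra' u w) f = cobordantT' u w ^ a * g)
    (hTg : ¬ cobordantT' u w ∣ g)
    (hg2 : algebraMap (cobordantAlgebra' u w) (Localization.AtPrime 𝔫) g ∈ maximalIdeal (Localization.AtPrime 𝔫) ^ 2) :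
    ι (Localization.AtPrime 𝔫) (algebraMap (cobordantAlgebra' u w) (Localization.AtPrime 𝔫) g) < ι S f := by
  haveI : IsRegularLocalRing (Localization.AtPrime P) := isRegularLocalRing_localization_atPrime S P
  obtain ⟨P₂, hP₂, -, -, -, -, n₂, u₂, w₂, -, -, -, -, hpres, -, hdrop₂⟩ :=
    hclause k₀ (Localization.AtPrime P) (algebraMap S (Localization.AtPrime P) f) hdim hf0 hf2
  haveI := hP₂
  refine iota_successor_lt_of_over_generic_point hι S u w P (weightedMonomialIdeal u₂ w₂) (fun m => ?_) hcontr f hιP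
    ?_ 𝔫 hT hP𝔫 hV hgen a g hfg hTg hg2
  · rw [hpres m, hval m]
  · intro 𝔫' _ hT' hP' hV' a' g' hfg' hTg' hg2'
    have hP₂le : P₂.map (algebraMap (Localization.AtPrime P) (cobordantAlgebra' u₂ w₂)) ≤ 𝔫' := by
      refine le_trans (Ideal.map_mono ?_) hP'
      rw [Localization.AtPrime.map_eq_maximalIdeal]
      exact IsLocalRing.le_maximalIdeal hP₂.ne_top
    exact hdrop₂ 𝔫' hT' hP₂le hV' a' g' hfg' hTg' hg2'

end Clause

/-! ## Consumer form from the (pres) equation and the top-stratum identification alone (appended 2026-08-27 13:3xZ) -/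

section Pres

/-- **(o36a), (pres) FORM — the interface the CURVE° assembler holds.**  At a position `(S, f)` (over a perfect field of
characteristic `p`, `S` regular local e.f.t.) with a prime `P` such that the top `ι`-stratum of `f` is `V(P)`
(`hE`, the (strat) identification), `S_P` of Krull dimension `≤ d`, `0 ≠ f/1 ∈ 𝔪_{S_P}²`, and a family `(u, w)` PRESENTING the
cylinder: `∀ m, weightedMonomialIdeal u w m = jCylinder ι J₂ S f m` (`hpres`, the (pres) equation of
`…ContactCylinderPresentationLocal.cylinder_pres_local`): if `CanonicalGameClauseLE d p ι J₂` holds, every TYPE (a) successor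
of the move `(u, w)` drops.  The contractedness of the pieces and their value at `S_P` are CONSEQUENCES of `hpres` and `hE`
(`𝒥ₘ = (J₂ (S_P) (f/1) m) ∩ S`, `IsLocalization.map_under`), so no padding lemma is needed here. [OURS · L1 W4.3 · (o36a)] -/
theorem iota_successor_lt_of_over_generic_point_of_pres
    {ι : (R : Type) → [CommRing R] → R → Ordinal.{0}} (hι : IotaIsoInvariant ι)
    {J₂ : (R : Type) → [CommRing R] → R → ℕ → Ideal R} {d p : ℕ} (hclause : CanonicalGameClauseLE d p ι J₂)
    (k₀ : Type) [Field k₀] [CharP k₀ p] [PerfectField k₀]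
    (S : Type) [CommRing S] [IsRegularLocalRing S] [Algebra k₀ S] [Algebra.EssFiniteType k₀ S]
    (P : Ideal S) [P.IsPrime] (hdim : ringKrullDim (Localization.AtPrime P) ≤ d)
    (f : S) (hf0 : algebraMap S (Localization.AtPrime P) f ≠ 0)
    (hf2 : algebraMap S (Localization.AtPrime P) f ∈ maximalIdeal (Localization.AtPrime P) ^ 2)
    (hE : topStratum ι S f = {𝔮 | P ≤ 𝔮.asIdeal})
    {n : ℕ} (u : Fin n → S) (w : Fin n → ℕ) (hpres : ∀ m, weightedMonomialIdeal u w m = jCylinder ι J₂ S f m)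
    (𝔫 : Ideal (cobordantAlgebra' u w)) [𝔫.IsPrime] (hT : cobordantT' u w ∈ 𝔫)
    (hP𝔫 : P.map (algebraMap S (cobordantAlgebra' u w)) ≤ 𝔫)
    (hV : ¬ extReesAlgebra.vertexIdeal (weightedMonomialIdeal u w) ≤ 𝔫)
    (hgen : 𝔫.comap (algebraMap S (cobordantAlgebra' u w)) ≤ P)
    (a : ℕ) (g : cobordantAlgebra' u w) (hfg : algebraMap S (cobordantAlgebra' u w) f = cobordantT' u w ^ a * g)
    (hTg : ¬ cobordantT' u w ∣ g)
    (hg2 : algebraMap (cobordantAlgebra' u w) (Localization.AtPrime 𝔫) g ∈ maximalIdeal (Localization.AtPrime 𝔫) ^ 2) :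
    ι (Localization.AtPrime 𝔫) (algebraMap (cobordantAlgebra' u w) (Localization.AtPrime 𝔫) g) < ι S f := by
  -- `P` lies on the top stratum, so `ι` is kept at `S_P`
  have hιP : ι (Localization.AtPrime P) (algebraMap S (Localization.AtPrime P) f) = ι S f := by
    have hmem : (⟨P, inferInstance⟩ : PrimeSpectrum S) ∈ topStratum ι S f := by
      rw [hE]
      exact (le_rfl : P ≤ P)
    exact hmem
  -- the pieces are the contractions of `J₂ (S_P) (f/1) m`
  have hcyl : ∀ m, weightedMonomialIdeal u w m =
      (J₂ (Localization.AtPrime P) (algebraMap S (Localization.AtPrime P) f) m).comap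
        (algebraMap S (Localization.AtPrime P)) := fun m => by
    rw [hpres m, jCylinder_eq_of_topStratum_eq ι J₂ S f m hE]
  have hval : ∀ m, (weightedMonomialIdeal u w m).map (algebraMap S (Localization.AtPrime P)) =
      J₂ (Localization.AtPrime P) (algebraMap S (Localization.AtPrime P) f) m := fun m => by
    rw [hcyl m, ← Ideal.under_def, IsLocalization.map_under P.primeCompl]
  have hcontr : ∀ m, ((weightedMonomialIdeal u w m).map (algebraMap S (Localization.AtPrime P))).comap
      (algebraMap S (Localization.AtPrime P)) = weightedMonomialIdeal u w m := fun m => by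
    rw [hval m, ← hcyl m]
  exact iota_successor_lt_of_over_generic_point_of_clause hι hclause k₀ S P hdim f hf0 hf2 hιP u w hcontr hval 𝔫 hT
    hP𝔫 hV hgen a g hfg hTg hg2

end Pres

end ContactCylinder

end Summit.ResolutionOfSingularities.ResolutionOfSingularities.Theorems

end
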